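import Summits.FinalStateConjecture.FinalStateConjecture.Theorems.EIHFluxBalanceModulatedKerrHandoffOneHoleCalculus

/-!
# Route EIHFluxBalance — `ModulatedKerrHandoff`, stub `stub_oneHoleMatching`: Leibniz and Faà di Bruno sizes

Helper file for the crux `stmt-FinalStateConjecture-10167`
(`Summit.FinalStateConjecture.FinalStateConjecture.Theses.EIHFluxBalance.ModulatedKerrHandoff`),
line `photon-rocket-modulation`, stub `stub_oneHoleMatching` (one-hole profile matching);
continuation of `…OneHoleCalculus` (pointwise `Cⁿ` size statements
`ContDiffAt ℝ n f x ∧ ∀ i ≤ n, ‖iteratedFDeriv ℝ i f x‖ ≤ C`, kept as plain conjunctions).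

Contents: the Leibniz bound for bounded bilinear pairings (`ck_bilinear`, constant
`‖B‖ 2ⁿ C_f C_g`, with the special cases `ck_smul`, `ck_clm_apply`, `ck_clm_comp`), the Faà di
Bruno bound for compositions (`ck_comp`, constant `n! C (max 1 D)ⁿ`; `ck₁_comp_of_ck₁` for an
outer function all of whose derivatives of POSITIVE order are small — the mechanism by which
tameness of a modulus `u ↦ Λ(u)` propagates to `x ↦ Λ(U(x))`), the order shift `ck_fderiv`, and
the uniform size on compact subsets of an open domain of smoothness
(`exists_forall_ck_of_isCompact`). Mathlib: `ContinuousLinearMap.norm_iteratedFDerivWithin_le_of_bilinear`,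
`norm_iteratedFDerivWithin_comp_le`; Dieudonné 1960, (8.12.7)–(8.12.10). [folklore]
-/

noncomputable section

-- `Summit.<S>.<S>.…` (single-problem summit, D-0017) trips core's duplicate-namespace linter.
set_option linter.dupNamespace false

open Set Filter Function
open scoped Topology ContDiff

namespace Summit.FinalStateConjecture.FinalStateConjecture.Theorems

namespace OneHole

variable {E F G H : Type*} [NormedAddCommGroup E] [NormedSpace ℝ E] [NormedAddCommGroup F]
  [NormedSpace ℝ F] [NormedAddCommGroup G] [NormedSpace ℝ G] [NormedAddCommGroup H]
  [NormedSpace ℝ H]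

/-! ### Bounded bilinear pairings (Leibniz) -/

/-- Binomial bookkeeping: `Σᵢ C(n,i) aᵢ b_{n−i} ≤ 2ⁿ α β` when `aᵢ ≤ α`, `0 ≤ bᵢ ≤ β`. [folklore] -/
theorem sum_choose_mul_le {n : ℕ} {a b : ℕ → ℝ} {α β : ℝ} (hα : 0 ≤ α) (ha : ∀ i ≤ n, a i ≤ α)
    (hb0 : ∀ i, 0 ≤ b i) (hb : ∀ i ≤ n, b i ≤ β) :
    ∑ i ∈ Finset.range (n + 1), (n.choose i : ℝ) * a i * b (n - i) ≤ 2 ^ n * α * β := by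
  calc ∑ i ∈ Finset.range (n + 1), (n.choose i : ℝ) * a i * b (n - i)
      ≤ ∑ i ∈ Finset.range (n + 1), (n.choose i : ℝ) * (α * β) := by
        refine Finset.sum_le_sum fun i hi ↦ ?_
        have hin : i ≤ n := Nat.lt_succ_iff.mp (Finset.mem_range.mp hi)
        rw [mul_assoc]
        exact mul_le_mul_of_nonneg_left
          (mul_le_mul (ha i hin) (hb _ (Nat.sub_le n i)) (hb0 _) hα) (Nat.cast_nonneg _)
    _ = 2 ^ n * α * β := by
        rw [← Finset.sum_mul, mul_assoc]
        congr 1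
        exact_mod_cast Nat.sum_range_choose n

/-- **Leibniz bound.** For a bounded bilinear pairing `B`, sizes `C_f`, `C_g` of `f`, `g` at `x`
give size `‖B‖ 2ⁿ C_f C_g` of `B(f, g)` (Mathlib's `norm_iteratedFDerivWithin_le_of_bilinear` on an
open neighbourhood). [folklore] -/
theorem ck_bilinear {n : ℕ} {f : E → F} {g : E → G} {x : E} {Cf Cg : ℝ} (B : F →L[ℝ] G →L[ℝ] H)
    (hf : ContDiffAt ℝ n f x ∧ ∀ i ≤ n, ‖iteratedFDeriv ℝ i f x‖ ≤ Cf)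
    (hg : ContDiffAt ℝ n g x ∧ ∀ i ≤ n, ‖iteratedFDeriv ℝ i g x‖ ≤ Cg) :
    ContDiffAt ℝ n (fun y ↦ B (f y) (g y)) x ∧
      ∀ i ≤ n, ‖iteratedFDeriv ℝ i (fun y ↦ B (f y) (g y)) x‖ ≤ ‖B‖ * 2 ^ n * Cf * Cg := by
  obtain ⟨u, hu, hxu, hfu, hgu⟩ := exists_isOpen_contDiffOn₂ hf.1 hg.1
  have hcd : ContDiffAt ℝ n (fun y ↦ B (f y) (g y)) x :=
    ((B.contDiff.of_le le_top).contDiffAt.comp x hf.1).clm_apply hg.1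
  refine ⟨hcd, fun i hi ↦ ?_⟩
  have h := B.norm_iteratedFDerivWithin_le_of_bilinear (N := (n : ℕ∞)) hfu hgu hu.uniqueDiffOn hxu
    (n := i) (by exact_mod_cast hi)
  rw [iteratedFDerivWithin_of_isOpen i hu hxu] at h
  refine h.trans ?_
  have h2 := sum_choose_mul_le (n := i) (a := fun j ↦ ‖iteratedFDerivWithin ℝ j f u x‖)
    (b := fun j ↦ ‖iteratedFDerivWithin ℝ j g u x‖) (α := Cf) (β := Cg) (ck_nonneg hf)
    (fun j hj ↦ by rw [iteratedFDerivWithin_of_isOpen j hu hxu]; exact hf.2 j (hj.trans hi))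
    (fun j ↦ norm_nonneg _)
    (fun j hj ↦ by rw [iteratedFDerivWithin_of_isOpen j hu hxu]; exact hg.2 j (hj.trans hi))
  have h3 : (2 : ℝ) ^ i ≤ 2 ^ n := pow_le_pow_right₀ one_le_two hi
  calc ‖B‖ * ∑ j ∈ Finset.range (i + 1), (i.choose j : ℝ) * ‖iteratedFDerivWithin ℝ j f u x‖ *
        ‖iteratedFDerivWithin ℝ (i - j) g u x‖ ≤ ‖B‖ * (2 ^ i * Cf * Cg) :=
        mul_le_mul_of_nonneg_left h2 (norm_nonneg B)
    _ ≤ ‖B‖ * (2 ^ n * Cf * Cg) := mul_le_mul_of_nonneg_left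
        (mul_le_mul_of_nonneg_right (mul_le_mul_of_nonneg_right h3 (ck_nonneg hf)) (ck_nonneg hg))
        (norm_nonneg B)
    _ = ‖B‖ * 2 ^ n * Cf * Cg := by ring

/-- Leibniz for scalar multiplication `f • g` (`f` real-valued). [folklore] -/
theorem ck_smul {n : ℕ} {f : E → ℝ} {g : E → F} {x : E} {Cf Cg : ℝ}
    (hf : ContDiffAt ℝ n f x ∧ ∀ i ≤ n, ‖iteratedFDeriv ℝ i f x‖ ≤ Cf)
    (hg : ContDiffAt ℝ n g x ∧ ∀ i ≤ n, ‖iteratedFDeriv ℝ i g x‖ ≤ Cg) :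
    ContDiffAt ℝ n (fun y ↦ f y • g y) x ∧
      ∀ i ≤ n, ‖iteratedFDeriv ℝ i (fun y ↦ f y • g y) x‖ ≤ 2 ^ n * Cf * Cg := by
  have h := ck_bilinear (ContinuousLinearMap.lsmul ℝ ℝ : ℝ →L[ℝ] F →L[ℝ] F) hf hg
  refine ⟨h.1, fun i hi ↦ (h.2 i hi).trans ?_⟩
  have h1 : ‖(ContinuousLinearMap.lsmul ℝ ℝ : ℝ →L[ℝ] F →L[ℝ] F)‖ ≤ 1 :=
    ContinuousLinearMap.opNorm_lsmul_le
  have h0 : 0 ≤ 2 ^ n * Cf * Cg := by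
    have := ck_nonneg hf; have := ck_nonneg hg; positivity
  nlinarith

/-- Leibniz for the product of two real functions. [folklore] -/
theorem ck_mul {n : ℕ} {f g : E → ℝ} {x : E} {Cf Cg : ℝ}
    (hf : ContDiffAt ℝ n f x ∧ ∀ i ≤ n, ‖iteratedFDeriv ℝ i f x‖ ≤ Cf)
    (hg : ContDiffAt ℝ n g x ∧ ∀ i ≤ n, ‖iteratedFDeriv ℝ i g x‖ ≤ Cg) :
    ContDiffAt ℝ n (fun y ↦ f y * g y) x ∧
      ∀ i ≤ n, ‖iteratedFDeriv ℝ i (fun y ↦ f y * g y) x‖ ≤ 2 ^ n * Cf * Cg :=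
  ck_smul hf hg

/-- Leibniz for the application of an operator-valued function to a vector-valued one. [folklore] -/
theorem ck_clm_apply {n : ℕ} {f : E → F →L[ℝ] G} {g : E → F} {x : E} {Cf Cg : ℝ}
    (hf : ContDiffAt ℝ n f x ∧ ∀ i ≤ n, ‖iteratedFDeriv ℝ i f x‖ ≤ Cf)
    (hg : ContDiffAt ℝ n g x ∧ ∀ i ≤ n, ‖iteratedFDeriv ℝ i g x‖ ≤ Cg) :
    ContDiffAt ℝ n (fun y ↦ f y (g y)) x ∧
      ∀ i ≤ n, ‖iteratedFDeriv ℝ i (fun y ↦ f y (g y)) x‖ ≤ 2 ^ n * Cf * Cg := by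
  have h := ck_bilinear (ContinuousLinearMap.id ℝ (F →L[ℝ] G)) hf hg
  refine ⟨h.1, fun i hi ↦ (h.2 i hi).trans ?_⟩
  have h1 : ‖ContinuousLinearMap.id ℝ (F →L[ℝ] G)‖ ≤ 1 := ContinuousLinearMap.norm_id_le
  have h0 : 0 ≤ 2 ^ n * Cf * Cg := by
    have := ck_nonneg hf; have := ck_nonneg hg; positivity
  nlinarith

/-- Leibniz for the composition of two operator-valued functions. [folklore] -/
theorem ck_clm_comp {n : ℕ} {f : E → G →L[ℝ] H} {g : E → F →L[ℝ] G} {x : E} {Cf Cg : ℝ}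
    (hf : ContDiffAt ℝ n f x ∧ ∀ i ≤ n, ‖iteratedFDeriv ℝ i f x‖ ≤ Cf)
    (hg : ContDiffAt ℝ n g x ∧ ∀ i ≤ n, ‖iteratedFDeriv ℝ i g x‖ ≤ Cg) :
    ContDiffAt ℝ n (fun y ↦ (f y).comp (g y)) x ∧
      ∀ i ≤ n, ‖iteratedFDeriv ℝ i (fun y ↦ (f y).comp (g y)) x‖ ≤ 2 ^ n * Cf * Cg := by
  have h := ck_bilinear (ContinuousLinearMap.compL ℝ F G H) hf hg
  refine ⟨h.1, fun i hi ↦ (h.2 i hi).trans ?_⟩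
  have h1 := ContinuousLinearMap.norm_compL_le ℝ F G H
  have h0 : 0 ≤ 2 ^ n * Cf * Cg := by
    have := ck_nonneg hf; have := ck_nonneg hg; positivity
  nlinarith

/-! ### Composition (Faà di Bruno) -/

/-- **Faà di Bruno bound.** Size `C` of `g` at `f x` and positive-order size `D` of `f` at `x` give
size `n! C (max 1 D)ⁿ` of `g ∘ f` at `x` (Mathlib's `norm_iteratedFDerivWithin_comp_le` on open
neighbourhoods). [folklore] -/
theorem ck_comp {n : ℕ} {g : F → G} {f : E → F} {x : E} {C D : ℝ}
    (hg : ContDiffAt ℝ n g (f x) ∧ ∀ i ≤ n, ‖iteratedFDeriv ℝ i g (f x)‖ ≤ C)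
    (hf : ContDiffAt ℝ n f x ∧ ∀ i, 1 ≤ i → i ≤ n → ‖iteratedFDeriv ℝ i f x‖ ≤ D) :
    ContDiffAt ℝ n (fun y ↦ g (f y)) x ∧
      ∀ i ≤ n, ‖iteratedFDeriv ℝ i (fun y ↦ g (f y)) x‖ ≤ n.factorial * C * max 1 D ^ n := by
  obtain ⟨t, ht, hxt, hgt⟩ := exists_isOpen_contDiffOn hg.1
  obtain ⟨s', hs', hxs', hfs'⟩ := exists_isOpen_contDiffOn hf.1
  set s : Set E := s' ∩ f ⁻¹' t with hs_def
  have hs : IsOpen s := hfs'.continuousOn.isOpen_inter_preimage hs' ht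
  have hxs : x ∈ s := ⟨hxs', hxt⟩
  have hfs : ContDiffOn ℝ n f s := hfs'.mono inter_subset_left
  have hmaps : MapsTo f s t := fun y hy ↦ hy.2
  have hcd : ContDiffAt ℝ n (fun y ↦ g (f y)) x := hg.1.comp x hf.1
  have hC0 : 0 ≤ C := ck_nonneg hg
  have hD1 : 1 ≤ max 1 D := le_max_left _ _
  refine ⟨hcd, fun i hi ↦ ?_⟩
  have h := norm_iteratedFDerivWithin_comp_le (g := g) (f := f) (n := i) (N := (n : ℕ∞)) (x := x)
    hgt hfs (by exact_mod_cast hi) ht.uniqueDiffOn hs.uniqueDiffOn hmaps hxs (C := C) (D := max 1 D)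
    (fun j hj ↦ by
      rw [iteratedFDerivWithin_of_isOpen j ht hxt]
      exact hg.2 j (hj.trans hi))
    (fun j hj1 hj ↦ by
      rw [iteratedFDerivWithin_of_isOpen j hs hxs]
      exact ((hf.2 j hj1 (hj.trans hi)).trans (le_max_right 1 D)).trans
        (le_self_pow₀ hD1 (by omega)))
  rw [iteratedFDerivWithin_of_isOpen i hs hxs] at h
  refine h.trans ?_
  have h1 : (i.factorial : ℝ) ≤ n.factorial := by exact_mod_cast Nat.factorial_le hi
  have h2 : max 1 D ^ i ≤ max 1 D ^ n := pow_le_pow_right₀ hD1 hi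
  exact mul_le_mul (mul_le_mul_of_nonneg_right h1 hC0) h2 (by positivity) (by positivity)

/-- Positive-order size of a composition (the bound of `ck_comp` for the orders `1 … n`).
[folklore] -/
theorem ck₁_comp {n : ℕ} {g : F → G} {f : E → F} {x : E} {C D : ℝ}
    (hg : ContDiffAt ℝ n g (f x) ∧ ∀ i ≤ n, ‖iteratedFDeriv ℝ i g (f x)‖ ≤ C)
    (hf : ContDiffAt ℝ n f x ∧ ∀ i, 1 ≤ i → i ≤ n → ‖iteratedFDeriv ℝ i f x‖ ≤ D) :
    ContDiffAt ℝ n (fun y ↦ g (f y)) x ∧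
      ∀ i, 1 ≤ i → i ≤ n →
        ‖iteratedFDeriv ℝ i (fun y ↦ g (f y)) x‖ ≤ n.factorial * C * max 1 D ^ n :=
  ck₁_of_ck (ck_comp hg hf)

/-- **Outer function with small derivatives.** If only the derivatives of orders `1 ≤ i ≤ n` of
`g` at `f x` are bounded (by `η`), the derivatives of orders `1 ≤ i ≤ n` of `g ∘ f` are bounded by
`n! (max η 0) (max 1 D)ⁿ` (apply `ck_comp` to `g − g(f x)`). [folklore] -/
theorem ck₁_comp_of_ck₁ {n : ℕ} {g : F → G} {f : E → F} {x : E} {η D : ℝ}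
    (hg : ContDiffAt ℝ n g (f x) ∧ ∀ i, 1 ≤ i → i ≤ n → ‖iteratedFDeriv ℝ i g (f x)‖ ≤ η)
    (hf : ContDiffAt ℝ n f x ∧ ∀ i, 1 ≤ i → i ≤ n → ‖iteratedFDeriv ℝ i f x‖ ≤ D) :
    ContDiffAt ℝ n (fun y ↦ g (f y)) x ∧
      ∀ i, 1 ≤ i → i ≤ n →
        ‖iteratedFDeriv ℝ i (fun y ↦ g (f y)) x‖ ≤ n.factorial * max η 0 * max 1 D ^ n := by
  set g' : F → G := fun z ↦ g z - g (f x) with hg'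
  have hg'0 : ContDiffAt ℝ n g' (f x) ∧ ∀ i ≤ n, ‖iteratedFDeriv ℝ i g' (f x)‖ ≤ max η 0 := by
    refine ⟨hg.1.sub contDiffAt_const, fun i hi ↦ ?_⟩
    rcases Nat.eq_zero_or_pos i with rfl | hi1
    · simp [hg']
    · rw [hg', show (fun z ↦ g z - g (f x)) = g - fun _ ↦ g (f x) from rfl,
        iteratedFDeriv_sub_apply (hg.1.of_le (by exact_mod_cast hi)) contDiffAt_const,
        iteratedFDeriv_const_of_ne (by omega), Pi.zero_apply, sub_zero]
      exact (hg.2 i hi1 hi).trans (le_max_left _ _)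
  have hc := ck_comp hg'0 hf
  refine ⟨hg.1.comp x hf.1, fun i hi1 hi ↦ ?_⟩
  have he : (fun y ↦ g (f y)) = (fun y ↦ g' (f y)) + fun _ ↦ g (f x) := by
    funext y; simp [hg']
  rw [he, iteratedFDeriv_add_apply (hc.1.of_le (by exact_mod_cast hi)) contDiffAt_const,
    iteratedFDeriv_const_of_ne (by omega), Pi.zero_apply, add_zero]
  exact hc.2 i hi

/-! ### Shifting the order: the derivative as a function -/

/-- The derivatives of orders `≤ n` of `Df` are the derivatives of orders `1, …, n + 1` of `f`.
[folklore] -/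
theorem ck_fderiv {n : ℕ} {f : E → F} {x : E} {C : ℝ}
    (hf : ContDiffAt ℝ (n + 1 : ℕ) f x ∧
      ∀ i, 1 ≤ i → i ≤ n + 1 → ‖iteratedFDeriv ℝ i f x‖ ≤ C) :
    ContDiffAt ℝ n (fderiv ℝ f) x ∧ ∀ i ≤ n, ‖iteratedFDeriv ℝ i (fderiv ℝ f) x‖ ≤ C := by
  refine ⟨hf.1.fderiv_right (by push_cast; exact le_rfl), fun i hi ↦ ?_⟩
  rw [norm_iteratedFDeriv_fderiv]
  exact hf.2 (i + 1) (by omega) (by omega)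

/-! ### Uniform bounds on compact sets -/

/-- **Uniform `Cⁿ` size on a compact subset of an open domain of smoothness**: if `f` is `Cⁿ` on the
open set `O ⊇ K`, `K` compact, there is ONE constant `C ≥ 0` bounding all derivatives of orders
`≤ n` at all points of `K` (continuity of `x ↦ Dⁱf(x)` on `O`). [folklore] -/
theorem exists_forall_ck_of_isCompact {n : ℕ} {f : E → F} {O K : Set E} (hO : IsOpen O)
    (hf : ContDiffOn ℝ n f O) (hK : IsCompact K) (hKO : K ⊆ O) :
    ∃ C : ℝ, 0 ≤ C ∧ ∀ x ∈ K, ContDiffAt ℝ n f x ∧ ∀ i ≤ n, ‖iteratedFDeriv ℝ i f x‖ ≤ C := by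
  have hbound : ∀ i ≤ n, ∃ C : ℝ, ∀ x ∈ K, ‖iteratedFDeriv ℝ i f x‖ ≤ C := by
    intro i hi
    have hcont : ContinuousOn (iteratedFDeriv ℝ i f) O := by
      have h1 := hf.continuousOn_iteratedFDerivWithin (m := i) (by exact_mod_cast hi)
        hO.uniqueDiffOn
      exact h1.congr fun p hp ↦ (iteratedFDerivWithin_of_isOpen i hO hp).symm
    exact hK.exists_bound_of_continuousOn (hcont.mono hKO)
  choose! C hC using hbound
  refine ⟨∑ i ∈ Finset.range (n + 1), |C i|, Finset.sum_nonneg fun _ _ ↦ abs_nonneg _,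
    fun x hx ↦ ⟨(hf x (hKO hx)).contDiffAt (hO.mem_nhds (hKO hx)), fun i hi ↦ ?_⟩⟩
  have h1 := ((hC i hi x hx).trans (le_abs_self (C i)))
  exact h1.trans (Finset.single_le_sum (f := fun k ↦ |C k|) (fun _ _ ↦ abs_nonneg _)
    (Finset.mem_range.mpr (Nat.lt_succ_of_le hi)))

end OneHole

/-- Registered sub-goal form (stub `oneHole_ck_comp` of the crux item) of `OneHole.ck_comp`: the Faà
di Bruno size `n! C (max 1 D)ⁿ` of a composition at a point. [folklore] -/
theorem oneHole_ck_comp : ∀ {E F G : Type*} [NormedAddCommGroup E] [NormedSpace ℝ E] [NormedAddCommGroup F] [NormedSpace ℝ F] [NormedAddCommGroup G] [NormedSpace ℝ G] {n : ℕ} {g : F → G} {f : E → F} {x : E} {C D : ℝ}, (ContDiffAt ℝ n g (f x) ∧ ∀ i ≤ n, ‖iteratedFDeriv ℝ i g (f x)‖ ≤ C) → (ContDiffAt ℝ n f x ∧ ∀ i, 1 ≤ i → i ≤ n → ‖iteratedFDeriv ℝ i f x‖ ≤ D) → ContDiffAt ℝ n (fun y ↦ g (f y)) x ∧ ∀ i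 ≤ n, ‖iteratedFDeriv ℝ i (fun y ↦ g (f y)) x‖ ≤ n.factorial * C * max 1 D ^ n :=
  fun hg hf ↦ OneHole.ck_comp hg hf

end Summit.FinalStateConjecture.FinalStateConjecture.Theorems

end
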